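import Literature.Probability.RandomPlanarGeometry.ExcursionRestrictionHarmonic
import HarnessLib

/-!
# First-order behaviour of the restriction map `Φ_A` at the boundary point `0`

For a `*`-hull `A` and its restriction map `Φ = Φ_A : ℍ ∖ A → ℍ` (`Φ(0) = 0`, `Φ(z) ∼ z` at
`∞`) with `Φ'_A(0) = d` (`HasRestrictionDeriv A Φ d`), as `ζ → 0` inside `ℍ ∖ A` in an
ARBITRARY manner (tangential approach allowed):

* `Im Φ(ζ) / Im ζ → d`;
* `Φ'(ζ) → d`.

Both follow from the Schwarz reflection of `Φ` across `ℝ ∖ A` (the tree's `hullExt Φ`,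
`StarHullExtension`), which is holomorphic on the open symmetric domain `ℂ ∖ (A ∪ Ā) ∋ 0` with
`(hullExt Φ)'(0) = d`: the first limit is the tree's
`IsRestrictionMap.tendsto_im_div_im_nhdsWithin_zero` (`ExcursionRestrictionHarmonic`), the second
is continuity of the derivative of a holomorphic function, since `Φ' = (hullExt Φ)'` on the open
set `ℍ ∖ A`.

Reference: G. F. Lawler, O. Schramm, W. Werner, *Conformal restriction: the chordal case*,
J. Amer. Math. Soc. **16** (2003), proof of Lemma 3.5 (p. 12: "the maps may be extended to a
neighborhood of `0` by Schwarz reflection in the real line").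
-/

noncomputable section

open scoped Topology
open Filter Set Metric Complex
open Literature.Probability.RandomPlanarGeometry
open UpperHalfPlane (upperHalfPlaneSet isOpen_upperHalfPlaneSet)

namespace Summit.CriticalPhenomena.SAWScalingLimit.Theorems.IsingBoundaryRatio

/-- **The derivative of a restriction map is continuous up to the boundary point `0`**:
`Φ'(ζ) → Φ'_A(0) = d` as `ζ → 0` inside `ℍ ∖ A` (Schwarz reflection: `Φ = hullExt Φ` on the
open set `ℍ ∖ A`, and `hullExt Φ` is holomorphic near `0` with derivative `d` there).
[cite: LawlerSchrammWerner2003Restriction, proof of Lemma 3.5 (p. 12)] -/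
theorem tendsto_deriv_restrictionMap_nhdsWithin_zero {A : Set ℂ}
    {Φ : ConformalEquiv (upperHalfPlaneSet \ A) upperHalfPlaneSet} {d : ℝ} (hA : IsStarHull A)
    (hΦ : IsRestrictionMap A Φ) (hd : HasRestrictionDeriv A Φ d) :
    Tendsto (fun ζ : ℂ => deriv (fun x => Φ x) ζ) (𝓝[upperHalfPlaneSet \ A] 0) (𝓝 (d : ℂ)) := by
  have hO : IsOpen (symmDomain A) := isOpen_symmDomain hA.1.isClosed
  have h0 : (0 : ℂ) ∈ symmDomain A := hA.zero_mem_symmDomain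
  -- `(hullExt Φ)'` is continuous on the open symmetric domain, with value `d` at `0`
  have hcont : ContinuousOn (deriv (hullExt Φ)) (symmDomain A) :=
    ((differentiableOn_hullExt hA.1 hΦ).contDiffOn (n := ⊤) hO).continuousOn_deriv_of_isOpen hO
      (by simp)
  have hE : Tendsto (deriv (hullExt Φ)) (𝓝 0) (𝓝 (d : ℂ)) := by
    have h := (hcont.continuousAt (hO.mem_nhds h0)).tendsto
    rwa [deriv_hullExt_zero hA hΦ hd] at h
  -- on the open set `ℍ ⊇ ℍ ∖ A`, `Φ = hullExt Φ`, so the derivatives agree there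
  refine (hE.mono_left nhdsWithin_le_nhds).congr' ?_
  filter_upwards [self_mem_nhdsWithin] with ζ hζ
  refine (Filter.EventuallyEq.deriv_eq ?_).symm
  filter_upwards [isOpen_upperHalfPlaneSet.mem_nhds hζ.1] with x hx
  exact (hullExt_of_im_pos hx).symm

/-- **First-order behaviour of `Φ_A` at `0`, approached arbitrarily inside `ℍ ∖ A`**: for a
`*`-hull `A`, a restriction map `Φ` of `A` and `d = Φ'_A(0)`, both `Im Φ(ζ)/Im ζ → d` and
`Φ'(ζ) → d` as `ζ → 0` in `ℍ ∖ A` ([LSW] proof of Lemma 3.5: `Φ` extends by Schwarz reflection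
to a function holomorphic on a disc about `0`, real on the real diameter, vanishing at `0` with
derivative `d`). The registered stub `stub_restrictionMapAtZero` of the line `fk-anchor-transfer`.
[cite: LawlerSchrammWerner2003Restriction, proof of Lemma 3.5 (p. 12)] -/
theorem stub_restrictionMapAtZero :
    ∀ (A : Set ℂ) (Φ : ConformalEquiv (UpperHalfPlane.upperHalfPlaneSet \ A) UpperHalfPlane.upperHalfPlaneSet)
      (d : ℝ), IsStarHull A → IsRestrictionMap A Φ → HasRestrictionDeriv A Φ d →
      Tendsto (fun ζ : ℂ => (Φ ζ).im / ζ.im) (𝓝[UpperHalfPlane.upperHalfPlaneSet \ A] 0) (𝓝 d) ∧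
      Tendsto (fun ζ : ℂ => deriv (fun x => Φ x) ζ) (𝓝[UpperHalfPlane.upperHalfPlaneSet \ A] 0) (𝓝 (d : ℂ)) :=
  fun _ _ _ hA hΦ hd ↦
    ⟨hΦ.tendsto_im_div_im_nhdsWithin_zero hA hd, tendsto_deriv_restrictionMap_nhdsWithin_zero hA hΦ hd⟩

end Summit.CriticalPhenomena.SAWScalingLimit.Theorems.IsingBoundaryRatio
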